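import Literature.Analysis.Fourier.FractalUncertaintyFourierTools
import HarnessLib

/-!
# A nonnegative integrable kernel with band-limited Fourier transform (for BD18 §3.4)

Topic `Literature/Analysis/Fourier`. The iteration argument of J. Bourgain, S. Dyatlov,
*Spectral gaps without the pressure condition*, Ann. of Math. 187 (2018), §3.4 uses "a nonnegative
Schwartz function `φ` with `supp φ̂ ⊂ [-1, 1]` and `∫ φ = 1`" to build the weights
`Ψ_n = 1_{U_{n+1}} * φ_{n+T}`. Only the following properties of `φ` are used there: `φ ≥ 0`,
`φ` continuous and integrable, `∫ φ = 1`, and `φ = 𝓕⁻ u` for a continuous integrable `u`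
vanishing off `[-1, 1]` (rapid decay is never used quantitatively: `T` is chosen large depending on
`δ, C_R` only). We construct such a pair explicitly and sorry-free:

* `im_fourierInv_ofReal_eq_zero` — `𝓕⁻ χ` is real-valued for `χ` real, even, integrable;
* `exists_kernel_of_bump` — from a continuous even real `χ` supported in `[-1/4, 1/4]` with
  `∫ χ² > 0`: `φ = (𝓕⁻ χ)² / ∫ χ²`, `u = (χ * χ) / ∫ χ²` (convolution theorem and Plancherel);
* `exists_bandlimitedKernel` — the existence statement used downstream (with the tent
  `χ(x) = max (1/4 - |x|) 0`).

No definitions are introduced (the kernel is consumed through `obtain`). [folklore]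
-/

namespace Literature.Analysis.Fourier

open _root_.MeasureTheory Set Function
open scoped FourierTransform ENNReal Convolution Pointwise Real

/-- The Fourier integrand `v ↦ 𝐞(v w) • f v` is integrable iff `f` is. [folklore] -/
theorem integrable_fourierChar_smul_iff {f : ℝ → ℂ} (w : ℝ) :
    Integrable (fun v : ℝ => 𝐞 (v * w) • f v) ↔ Integrable f := by
  have := (VectorFourier.fourierIntegral_convergent_iff (E := ℂ) (μ := volume)
    Real.continuous_fourierChar (L := -innerₗ ℝ) (by fun_prop) (f := f) w)
  simpa [mul_comm] using this

/-- If `χ : ℝ → ℝ` is integrable and even then `𝓕⁻ χ` is real-valued: the imaginary part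
`∫ sin(2π v x) χ(v) dv` is the integral of an odd function. [folklore] -/
theorem im_fourierInv_ofReal_eq_zero {χ : ℝ → ℝ} (hχ : Integrable χ) (heven : ∀ v, χ (-v) = χ v)
    (x : ℝ) : ((𝓕⁻ (fun v => (χ v : ℂ)) : ℝ → ℂ) x).im = 0 := by
  rw [fourierInv_real_eq]
  have hint : Integrable (fun v : ℝ => 𝐞 (v * x) • ((χ v : ℝ) : ℂ)) :=
    (integrable_fourierChar_smul_iff x).2 hχ.ofReal
  have h1 : (∫ v, 𝐞 (v * x) • ((χ v : ℝ) : ℂ)).im = ∫ v, (𝐞 (v * x) • ((χ v : ℝ) : ℂ)).im := by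
    have := integral_im hint
    simpa using this.symm
  have h2 : ∀ v, (𝐞 (v * x) • ((χ v : ℝ) : ℂ)).im = Real.sin (2 * π * (v * x)) * χ v := by
    intro v
    rw [Circle.smul_def, Real.fourierChar_apply, smul_eq_mul, Complex.im_mul_ofReal,
      Complex.exp_ofReal_mul_I_im]
  rw [h1]
  simp_rw [h2]
  set I := ∫ v, Real.sin (2 * π * (v * x)) * χ v with hI
  have hII : I = -I := by
    calc I = ∫ v, Real.sin (2 * π * ((-v) * x)) * χ (-v) :=
          (integral_neg_eq_self (fun v => Real.sin (2 * π * (v * x)) * χ v) volume).symm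
      _ = ∫ v, -(Real.sin (2 * π * (v * x)) * χ v) := by
          congr 1
          funext v
          rw [heven, show 2 * π * ((-v) * x) = -(2 * π * (v * x)) by ring, Real.sin_neg]
          ring
      _ = -I := integral_neg _
  linarith

/-- From a continuous, even, real bump `χ` supported in `[-1/4, 1/4]` with `∫ χ² > 0` we get a
kernel `φ ≥ 0`, continuous, integrable, `∫ φ = 1`, of the form `φ = 𝓕⁻ u` with `u` continuous,
integrable and vanishing off `[-1, 1]`: `φ = (𝓕⁻ χ)²/∫χ²`, `u = (χ ⋆ χ)/∫χ²`. [folklore] -/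
theorem exists_kernel_of_bump {χ : ℝ → ℝ} (hcont : Continuous χ) (heven : ∀ v, χ (-v) = χ v)
    (hsupp : ∀ x, x ∉ Icc (-4⁻¹ : ℝ) 4⁻¹ → χ x = 0) (hpos : 0 < ∫ x, χ x ^ 2) :
    ∃ φ : ℝ → ℝ, ∃ u : ℝ → ℂ, (∀ x, 0 ≤ φ x) ∧ Continuous φ ∧ Integrable φ ∧
      (∫ x, φ x = 1) ∧ Continuous u ∧ Integrable u ∧ (∀ ξ, ξ ∉ Icc (-1 : ℝ) 1 → u ξ = 0) ∧
      ∀ x, (φ x : ℂ) = (𝓕⁻ u : ℝ → ℂ) x := by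
  set χc : ℝ → ℂ := fun v => (χ v : ℂ) with hχc
  have hcontc : Continuous χc := Complex.continuous_ofReal.comp hcont
  have hsuppc : HasCompactSupport χc := by
    apply HasCompactSupport.intro (isCompact_Icc (a := (-4⁻¹ : ℝ)) (b := 4⁻¹))
    intro x hx
    simp [hχc, hsupp x hx]
  have hintc : Integrable χc := hcontc.integrable_of_hasCompactSupport hsuppc
  have hL2c : MemLp χc 2 volume := hcontc.memLp_of_hasCompactSupport hsuppc
  have hzero : ∀ x, x ∉ Icc (-4⁻¹ : ℝ) 4⁻¹ → χc x = 0 := fun x hx => by simp [hχc, hsupp x hx]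
  -- the convolution square
  set u₀ : ℝ → ℂ := χc ⋆[ContinuousLinearMap.mul ℂ ℂ, volume] χc with hu₀
  have hu₀cont : Continuous u₀ :=
    hsuppc.continuous_convolution_right _ hintc.locallyIntegrable hcontc
  have hu₀supp : HasCompactSupport u₀ := hsuppc.convolution _ hsuppc
  have hu₀int : Integrable u₀ := hu₀cont.integrable_of_hasCompactSupport hu₀supp
  have hu₀zero : ∀ ξ, ξ ∉ Icc (-1 : ℝ) 1 → u₀ ξ = 0 := by
    intro ξ hξ
    apply convolution_eq_zero_of_notMem_add hzero hzero
    intro h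
    obtain ⟨a, ha, b, hb, hab⟩ := h
    apply hξ
    simp only [mem_Icc] at ha hb ⊢
    constructor <;> linarith
  -- ψ = 𝓕⁻ χ is real, continuous, square-integrable
  set ψ : ℝ → ℂ := 𝓕⁻ χc with hψ
  have hχint : Integrable χ := hcont.integrable_of_hasCompactSupport (by
    apply HasCompactSupport.intro (isCompact_Icc (a := (-4⁻¹ : ℝ)) (b := 4⁻¹))
    intro x hx
    exact hsupp x hx)
  have hψim : ∀ x, (ψ x).im = 0 := fun x => im_fourierInv_ofReal_eq_zero hχint heven x
  have hψre : ∀ x, ψ x = (((ψ x).re : ℝ) : ℂ) := fun x =>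
    Complex.ext (by simp) (by simp [hψim x])
  have hψcont : Continuous ψ := by
    rw [hψ, Real.fourierInv_eq_fourier_comp_neg]
    exact Literature.Analysis.FunctionSpaces.continuous_fourierIntegral hintc.comp_neg
  have hψsq : Integrable (fun x => ‖ψ x‖ ^ 2) := integrable_norm_sq_fourierInv hintc hL2c
  have hnorm_re : ∀ x, ‖ψ x‖ ^ 2 = (ψ x).re ^ 2 := by
    intro x
    rw [Complex.sq_norm, Complex.normSq_apply, hψim x]
    ring
  -- Plancherel: `m := ∫ (Re ψ)² = ∫ χ² > 0`
  set m : ℝ := ∫ x, (ψ x).re ^ 2 with hm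
  have hmχ : m = ∫ x, χ x ^ 2 := by
    calc m = ∫ x, ‖ψ x‖ ^ 2 := by simp_rw [hnorm_re]; exact hm
      _ = ∫ v, ‖χc v‖ ^ 2 := integral_norm_sq_fourierInv_eq hintc hL2c
      _ = ∫ x, χ x ^ 2 := by
          congr 1
          funext v
          simp [hχc, Complex.norm_real, sq_abs]
  have hm0 : 0 < m := hmχ ▸ hpos
  -- `𝓕⁻ (χ ⋆ χ) = ψ²`
  have hFu₀ : ∀ x, (𝓕⁻ u₀ : ℝ → ℂ) x = ψ x * ψ x := fun x =>
    fourierInv_convolution_eq hintc hintc x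
  have hsmul : ∀ x, (𝓕⁻ (fun ξ => (m : ℂ)⁻¹ * u₀ ξ) : ℝ → ℂ) x =
      (m : ℂ)⁻¹ * (𝓕⁻ u₀ : ℝ → ℂ) x := by
    intro x
    change VectorFourier.fourierIntegral 𝐞 volume (-innerₗ ℝ) ((m : ℂ)⁻¹ • u₀) x =
      (m : ℂ)⁻¹ * VectorFourier.fourierIntegral 𝐞 volume (-innerₗ ℝ) u₀ x
    rw [VectorFourier.fourierIntegral_const_smul]
    rfl
  refine ⟨fun x => (ψ x).re ^ 2 / m, fun ξ => (m : ℂ)⁻¹ * u₀ ξ, ?_, ?_, ?_, ?_, ?_, ?_, ?_, ?_⟩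
  · intro x
    positivity
  · exact ((Complex.continuous_re.comp hψcont).pow 2).div_const m
  · have : Integrable (fun x => (ψ x).re ^ 2) := by
      refine hψsq.congr (Filter.Eventually.of_forall fun x => ?_)
      exact hnorm_re x
    exact this.div_const m
  · rw [integral_div, ← hm]
    exact div_self hm0.ne'
  · exact continuous_const.mul hu₀cont
  · exact hu₀int.const_mul _
  · intro ξ hξ
    simp [hu₀zero ξ hξ]
  · intro x
    rw [hsmul x, hFu₀ x, hψre x]
    push_cast
    field_simp

/-- A continuous, even, real bump supported in `[-1/4, 1/4]` with `∫ χ² > 0`: the tent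
`χ(x) = max (1/4 - |x|) 0`. [folklore] -/
theorem exists_even_bump : ∃ χ : ℝ → ℝ, Continuous χ ∧ (∀ v, χ (-v) = χ v) ∧
    (∀ x, x ∉ Icc (-4⁻¹ : ℝ) 4⁻¹ → χ x = 0) ∧ 0 < ∫ x, χ x ^ 2 := by
  refine ⟨fun x => max (4⁻¹ - |x|) 0, ?_, ?_, ?_, ?_⟩
  · fun_prop
  · intro v
    simp [abs_neg]
  · intro x hx
    simp only [mem_Icc, not_and_or, not_le] at hx
    apply max_eq_right
    rcases hx with h | h
    · have : (4⁻¹ : ℝ) < |x| := by rw [abs_of_neg (by linarith)]; linarith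
      linarith
    · have : (4⁻¹ : ℝ) < |x| := by rw [abs_of_pos (by linarith)]; linarith
      linarith
  · -- `χ ≥ 1/8` on `[0, 1/8]`, so `∫ χ² ≥ ∫_{[0,1/8]} 1/64 > 0`
    have hcont : Continuous (fun x : ℝ => max (4⁻¹ - |x|) 0) := by fun_prop
    have hcs : HasCompactSupport (fun x : ℝ => (max (4⁻¹ - |x|) 0) ^ 2) := by
      apply HasCompactSupport.intro (isCompact_Icc (a := (-4⁻¹ : ℝ)) (b := 4⁻¹))
      intro x hx
      simp only [mem_Icc, not_and_or, not_le] at hx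
      have : max (4⁻¹ - |x|) 0 = 0 := by
        apply max_eq_right
        rcases hx with h | h
        · have : (4⁻¹ : ℝ) < |x| := by rw [abs_of_neg (by linarith)]; linarith
          linarith
        · have : (4⁻¹ : ℝ) < |x| := by rw [abs_of_pos (by linarith)]; linarith
          linarith
      simp [this]
    have hint : Integrable (fun x : ℝ => (max (4⁻¹ - |x|) 0) ^ 2) :=
      (hcont.pow 2).integrable_of_hasCompactSupport hcs
    have hle : ∀ x ∈ Icc (0 : ℝ) 8⁻¹, (64 : ℝ)⁻¹ ≤ (max (4⁻¹ - |x|) 0) ^ 2 := by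
      intro x hx
      simp only [mem_Icc] at hx
      have h1 : (8 : ℝ)⁻¹ ≤ max (4⁻¹ - |x|) 0 := by
        rw [abs_of_nonneg hx.1]
        exact le_max_of_le_left (by linarith)
      calc (64 : ℝ)⁻¹ = (8⁻¹) ^ 2 := by norm_num
        _ ≤ (max (4⁻¹ - |x|) 0) ^ 2 := by gcongr
    calc (0 : ℝ) < (64 : ℝ)⁻¹ * (volume.real (Icc (0 : ℝ) 8⁻¹)) := by
          rw [Real.volume_real_Icc_of_le (by norm_num)]; norm_num
      _ = ∫ x in Icc (0 : ℝ) 8⁻¹, (64 : ℝ)⁻¹ := by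
          rw [setIntegral_const, smul_eq_mul, mul_comm]
      _ ≤ ∫ x in Icc (0 : ℝ) 8⁻¹, (max (4⁻¹ - |x|) 0) ^ 2 := by
          apply setIntegral_mono_on (integrableOn_const (by simp [Real.volume_Icc]))
            hint.integrableOn measurableSet_Icc hle
      _ ≤ ∫ x, (max (4⁻¹ - |x|) 0) ^ 2 :=
          setIntegral_le_integral hint (Filter.Eventually.of_forall fun x => sq_nonneg _)

/-- **A band-limited nonnegative kernel of mass one.** There exist `φ : ℝ → ℝ` and `u : ℝ → ℂ`
with `φ ≥ 0` continuous and integrable, `∫ φ = 1`, `u` continuous and integrable with `u = 0`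
off `[-1, 1]`, and `φ = 𝓕⁻ u` pointwise (so `supp φ̂ ⊂ [-1, 1]`). This is the kernel `φ` of BD18
§3.4 ("Let `φ` be a nonnegative Schwartz function such that `supp φ̂ ⊂ [-1,1]`, `∫ φ = 1`"),
except that Schwartz decay is not asserted (and not needed). [folklore] -/
theorem exists_bandlimitedKernel :
    ∃ φ : ℝ → ℝ, ∃ u : ℝ → ℂ, (∀ x, 0 ≤ φ x) ∧ Continuous φ ∧ Integrable φ ∧
      (∫ x, φ x = 1) ∧ Continuous u ∧ Integrable u ∧ (∀ ξ, ξ ∉ Icc (-1 : ℝ) 1 → u ξ = 0) ∧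
      ∀ x, (φ x : ℂ) = (𝓕⁻ u : ℝ → ℂ) x := by
  obtain ⟨χ, hcont, heven, hsupp, hpos⟩ := exists_even_bump
  exact exists_kernel_of_bump hcont heven hsupp hpos

end Literature.Analysis.Fourier
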